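import Summits.Ventures.HSemireg.Pad4TowerRuleDMu4
import Summits.Ventures.HSemireg.Pad4TowerLemmaT

/-!
# Venture HSemireg — PAD-4: the (F1ℝ) slice of RULE D on 𝔅(μ₄) IS `Pad4TowerLemmaT.RuleDN ∕ RuleDP ∕ RuleDClosed` (proved)

HONEST FRAMING. Lean index of the computation cell `pub-hsemireg` (S4-PUSH, H2 door PAD-4), typed by the Ventures-side typer
`hodge-lit-semireg-typer-2` (g2); companion of `Pad4TowerRuleDMu4` (RULE D on 𝔅(μ₄), PAD4-BALANCED §1′ ∕ bc5-plan g4 memo (0.3),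
all four phases). This file is the FAITHFULNESS CERTIFICATE of that predicate against the refereed (F1ℝ) one: it embeds the
paired-axes cells of `Pad4TowerLemmaT` (light-cone coordinates `(a_f, b_f) ∈ ℕ²` per factor, PAD4-BALANCED §1′ «(F1) IN LIGHT-CONE
COORDINATES … phases in {±1}») into `MCell` by `(a, b) ↦ (α, Re β, Im β) = (a + b, a − b, 0)` (the frame `w = 1`: `a = c₊`,
`b = c₋`) and PROVES, with no hypothesis, that a cell ∕ configuration satisfies `RuleDN` ∕ `RuleDP` ∕ `RuleDClosed` of
`Pad4TowerLemmaT` (= s4-search-1 `ruled_sat_q1.py` with `JOB_R2A=1`, ×2'd through LEMMA T's verdicts s4-ref g70 ∕ s4-ref-2 g9–g10)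
IFF its embedding satisfies `RuleDMu4N` ∕ `RuleDMu4P` ∕ `RuleDMu4Closed`.

WHAT THE PROOF CHECKS (and hence what the equivalence certifies about the μ₄ conventions). On slice points `Im β = 0`, so legs and
covers exist only in the two real directions `k = 0` (`a` up) and `k = 2` (`b` up) (`slice_ray_iff`, `uPartner_slice_iff`,
`cover_slice_iff`: a `k`-partner below in the embedding is exactly a `Pad4TowerLemmaT` leg along the side `s` with `k = dirOf s`,
an embedded cover exactly an (r2a) `CoverBelow ∕ CoverAbove`); the even coordinates are `2a`, `2b` (`coord_slice_dirOf`); the odd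
directions are adapted exactly at apex points `a = b`, where their coordinate is `a + b = 2a` and the apex clause of `DirOK` lets the
real covers resolve them (`slice_pick`) — this is where FLAG F-1 of `Pad4TowerRuleDMu4` is exercised: WITHOUT the apex clause the μ₄
predicate would be STRICTLY STRONGER than `RuleDN` on the slice (an unserved apex factor resolved by covers), with it the two agree;
`SettledBelow` in direction `dirOf s` unpacks to `ServedBelow … s` because the only other real direction is the antipode
(`dirOf_eq_of_ne_antip`). Both directions of all three equivalences are proved (`ruleDN_iff_slice`, `ruleDP_iff_slice`,
`ruleDClosed_iff_slice`).

WHAT IS NOT HERE. Anything about phases `±i` beyond what `Pad4TowerRuleDMu4` defines (the slice has none); the (E1)-meaning of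
either predicate (pencil, cited there); no statement about the cell's supports. Nothing is a statement about a variety, a sheaf,
`σ`, a seed or an abelian variety; NOTHING HERE SAYS THAT HC ∕ HC_CM ∕ HC_AV ∕ W₆ ∕ HC_Kum4Type HOLDS OR FAILS. No `instance`, no
notation, no named fact, 0 `sorry`; axioms standard.

SOURCES (sha16): `Pad4TowerRuleDMu4.lean` (this typer, same filing); `Pad4TowerLemmaT.lean` bfb2cc0a1a90b649 (p532659: `Cell`,
`Config`, `Agree1`, `Agree2`, `ServedBelow∕Above`, `CoverBelow∕Above`, `RuleDN`, `RuleDP`, `RuleDClosed`); PAD4-BALANCED-search-1.md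
v2.9 93790c5bf8784622 §1′ (FRAMES; «(F1) IN LIGHT-CONE COORDINATES»).
-/

namespace Summit.Ventures.HSemireg.Pad4Tower

open Finset

/-! ## The (F1ℝ) slice: `Pad4TowerLemmaT.RuleDN ∕ RuleDP ∕ RuleDClosed` are the restrictions of RULE D on 𝔅(μ₄) -/

section Slice

/-- the (F1ℝ) SLICE EMBEDDING of `Pad4TowerLemmaT`'s cells: light-cone coordinates `(a_f, b_f)` of a factor ↦ the balanced
point `(α, Re β, Im β) = (a + b, a − b, 0)` (§1′ FRAMES with `w = 1`: `a = c₊ = (α+β)∕2`, `b = c₋ = (α−β)∕2`; phases `±1`). -/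
def sliceCell (Z : Cell) : MCell := fun f => ((Z f 0 : ℤ) + Z f 1, (Z f 0 : ℤ) - Z f 1, 0)

/-- the slice embedding of a configuration (both levels). -/
def sliceConfig (C : Config) : MConfig := ⟨C.lower.image sliceCell, C.upper.image sliceCell⟩

/-- the null direction of a side: the `a`-coordinate (`s = 0`) is the direction of phase `+1` (`k = 0`), the `b`-coordinate
(`s = 1`) that of phase `−1` (`k = 2`). -/
abbrev dirOf (s : Fin 2) : Fin 4 := ![0, 2] s

/-- two cells have the same slice point on the factor `g` iff they agree on both sides of `g`. -/
theorem sliceCell_apply_eq_iff (X Y : Cell) (g : Fin 4) :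
    sliceCell X g = sliceCell Y g ↔ X g 0 = Y g 0 ∧ X g 1 = Y g 1 := by
  simp only [sliceCell, Prod.mk.injEq]
  constructor
  · rintro ⟨h1, h2, -⟩; constructor <;> omega
  · rintro ⟨h1, h2⟩; refine ⟨?_, ?_, trivial⟩ <;> omega

/-- the adapted light-cone coordinate of a slice point in the real direction `dirOf s` is `2·(side s)`. -/
theorem coord_slice_dirOf (Z : Cell) (f : Fin 4) (s : Fin 2) : coord (sliceCell Z f) (dirOf s) = 2 * (Z f s : ℤ) := by
  fin_cases s <;> simp [coord, sliceCell, dirOf] <;> ring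

/-- every slice point is adapted to both real directions (`β` has no imaginary part on the slice). -/
theorem adapted_slice_dirOf (Z : Cell) (f : Fin 4) (s : Fin 2) : Adapted (sliceCell Z f) (dirOf s) := by
  fin_cases s <;> simp [Adapted, sliceCell, dirOf]

/-- every adapted coordinate of a slice point is (twice) one of its two light-cone coordinates, through an admissible cover
direction: the even directions are the two sides themselves; an odd direction is adapted only at an apex point (`a = b`), where
the side-`0` direction is admissible (`DirOK` at an apex). -/
theorem slice_pick (Z : Cell) (g k : Fin 4) (hk : Adapted (sliceCell Z g) k) :
    ∃ s : Fin 2, coord (sliceCell Z g) k = 2 * (Z g s : ℤ) ∧ DirOK (sliceCell Z g) k (dirOf s) := by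
  fin_cases k
  · exact ⟨0, by simp [coord, sliceCell]; ring, Or.inl (by simp [dirOf])⟩
  · simp [Adapted, sliceCell] at hk
    exact ⟨0, by simp [coord, sliceCell]; omega, Or.inr ⟨⟨by simp [sliceCell]; omega, by simp [sliceCell]⟩, by decide⟩⟩
  · exact ⟨1, by simp [coord, sliceCell]; ring, Or.inl (by simp [dirOf])⟩
  · simp [Adapted, sliceCell] at hk
    exact ⟨0, by simp [coord, sliceCell]; omega, Or.inr ⟨⟨by simp [sliceCell]; omega, by simp [sliceCell]⟩, by decide⟩⟩

/-- `Agree1` unpacked: agreement off the factor, and on the other side of the factor. -/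
theorem agree1_iff (X Y : Cell) (f : Fin 4) (s : Fin 2) :
    Agree1 X Y f s ↔ (∀ g, g ≠ f → X g 0 = Y g 0 ∧ X g 1 = Y g 1) ∧ X f s.rev = Y f s.rev := by
  constructor
  · intro h
    exact ⟨fun g hg => ⟨h g 0 (by tauto), h g 1 (by tauto)⟩, h f s.rev (by fin_cases s <;> simp)⟩
  · rintro ⟨hoff, hrev⟩ g r hgr
    by_cases hg : g = f
    · subst hg
      have : r = s.rev := by
        fin_cases s <;> fin_cases r <;> simp_all
      subst this
      exact hrev
    · rcases hoff g hg with ⟨h0, h1⟩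
      fin_cases r
      · exact h0
      · exact h1

/-- `Agree2` unpacked (two different factors). -/
theorem agree2_iff (X Y : Cell) {g j : Fin 4} (hgj : g ≠ j) (s t : Fin 2) :
    Agree2 X Y g s j t ↔
      (∀ h, h ≠ g → h ≠ j → X h 0 = Y h 0 ∧ X h 1 = Y h 1) ∧ X g s.rev = Y g s.rev ∧ X j t.rev = Y j t.rev := by
  constructor
  · intro h
    refine ⟨fun h' h1 h2 => ⟨h h' 0 (by tauto) (by tauto), h h' 1 (by tauto) (by tauto)⟩,
      h g s.rev (by fin_cases s <;> simp) (by tauto), h j t.rev (by tauto) (by fin_cases t <;> simp)⟩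
  · rintro ⟨hoff, hg, hj⟩ h q h1 h2
    by_cases hhg : h = g
    · subst hhg
      have : q = s.rev := by fin_cases s <;> fin_cases q <;> simp_all
      subst this; exact hg
    · by_cases hhj : h = j
      · subst hhj
        have : q = t.rev := by fin_cases t <;> fin_cases q <;> simp_all
        subst this; exact hj
      · rcases hoff h hhg hhj with ⟨h0, h1'⟩
        fin_cases q
        · exact h0
        · exact h1'

/-- the factor arithmetic of the slice: `Y_f` lies `d ≥ 1` null steps of direction `k` above `X_f` iff `k` is one of the two real
directions and the corresponding light-cone coordinate went up, the other staying put. -/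
theorem slice_ray_iff (X Y : Cell) (f k : Fin 4) :
    ((sliceCell X f).1 < (sliceCell Y f).1 ∧
        sliceCell Y f = ray (sliceCell X f) k ((sliceCell Y f).1 - (sliceCell X f).1)) ↔
      (k = 0 ∧ X f 1 = Y f 1 ∧ X f 0 < Y f 0) ∨ (k = 2 ∧ X f 0 = Y f 0 ∧ X f 1 < Y f 1) := by
  fin_cases k <;> simp [sliceCell, ray, Prod.ext_iff] <;> omega

/-- a `k`-partner below in the slice is a leg along one of the two sides. -/
theorem uPartner_slice_iff (X Y : Cell) (f k : Fin 4) :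
    UPartner (sliceCell Y) (sliceCell X) f k ↔ ∃ s : Fin 2, k = dirOf s ∧ Agree1 X Y f s ∧ X f s < Y f s := by
  constructor
  · rintro ⟨hag, hlt, hray⟩
    have hoff : ∀ g, g ≠ f → X g 0 = Y g 0 ∧ X g 1 = Y g 1 := fun g hg => (sliceCell_apply_eq_iff X Y g).1 (hag g hg)
    rcases (slice_ray_iff X Y f k).1 ⟨hlt, hray⟩ with ⟨rfl, h1, h0⟩ | ⟨rfl, h0, h1⟩
    · exact ⟨0, by simp [dirOf], (agree1_iff X Y f 0).2 ⟨hoff, h1⟩, h0⟩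
    · exact ⟨1, by simp [dirOf], (agree1_iff X Y f 1).2 ⟨hoff, h0⟩, h1⟩
  · rintro ⟨s, rfl, hag, hlt⟩
    obtain ⟨hoff, hrev⟩ := (agree1_iff X Y f s).1 hag
    refine ⟨fun g hg => (sliceCell_apply_eq_iff X Y g).2 (hoff g hg), ?_⟩
    fin_cases s
    · exact (slice_ray_iff X Y f 0).2 (Or.inl ⟨rfl, hrev, hlt⟩)
    · exact (slice_ray_iff X Y f 2).2 (Or.inr ⟨rfl, hrev, hlt⟩)

/-- a cover in the slice is an (r2a) partner along two sides. -/
theorem cover_slice_iff (X Y : Cell) {g j : Fin 4} (hgj : g ≠ j) (a b : Fin 4) :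
    (MAgree2 (sliceCell X) (sliceCell Y) g j ∧ (sliceCell X g).1 < (sliceCell Y g).1 ∧
        sliceCell Y g = ray (sliceCell X g) a ((sliceCell Y g).1 - (sliceCell X g).1) ∧
        (sliceCell X j).1 < (sliceCell Y j).1 ∧
        sliceCell Y j = ray (sliceCell X j) b ((sliceCell Y j).1 - (sliceCell X j).1)) ↔
      ∃ s t : Fin 2, a = dirOf s ∧ b = dirOf t ∧ Agree2 X Y g s j t ∧ X g s < Y g s ∧ X j t < Y j t := by
  constructor
  · rintro ⟨hag, hltg, hrayg, hltj, hrayj⟩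
    have hoff : ∀ h, h ≠ g → h ≠ j → X h 0 = Y h 0 ∧ X h 1 = Y h 1 :=
      fun h h1 h2 => (sliceCell_apply_eq_iff X Y h).1 (hag h h1 h2)
    have hg := (slice_ray_iff X Y g a).1 ⟨hltg, hrayg⟩
    have hj := (slice_ray_iff X Y j b).1 ⟨hltj, hrayj⟩
    rcases hg with ⟨rfl, g1, g0⟩ | ⟨rfl, g0, g1⟩ <;> rcases hj with ⟨rfl, j1, j0⟩ | ⟨rfl, j0, j1⟩
    · exact ⟨0, 0, by simp [dirOf], by simp [dirOf], (agree2_iff X Y hgj 0 0).2 ⟨hoff, g1, j1⟩, g0, j0⟩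
    · exact ⟨0, 1, by simp [dirOf], by simp [dirOf], (agree2_iff X Y hgj 0 1).2 ⟨hoff, g1, j0⟩, g0, j1⟩
    · exact ⟨1, 0, by simp [dirOf], by simp [dirOf], (agree2_iff X Y hgj 1 0).2 ⟨hoff, g0, j1⟩, g1, j0⟩
    · exact ⟨1, 1, by simp [dirOf], by simp [dirOf], (agree2_iff X Y hgj 1 1).2 ⟨hoff, g0, j0⟩, g1, j1⟩
  · rintro ⟨s, t, rfl, rfl, hag, hlg, hlj⟩
    obtain ⟨hoff, hg, hj⟩ := (agree2_iff X Y hgj s t).1 hag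
    refine ⟨fun h h1 h2 => (sliceCell_apply_eq_iff X Y h).2 (hoff h h1 h2), ?_⟩
    have eg : (sliceCell X g).1 < (sliceCell Y g).1 ∧
        sliceCell Y g = ray (sliceCell X g) (dirOf s) ((sliceCell Y g).1 - (sliceCell X g).1) := by
      fin_cases s
      · exact (slice_ray_iff X Y g 0).2 (Or.inl ⟨rfl, hg, hlg⟩)
      · exact (slice_ray_iff X Y g 2).2 (Or.inr ⟨rfl, hg, hlg⟩)
    have ej : (sliceCell X j).1 < (sliceCell Y j).1 ∧
        sliceCell Y j = ray (sliceCell X j) (dirOf t) ((sliceCell Y j).1 - (sliceCell X j).1) := by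
      fin_cases t
      · exact (slice_ray_iff X Y j 0).2 (Or.inl ⟨rfl, hj, hlj⟩)
      · exact (slice_ray_iff X Y j 2).2 (Or.inr ⟨rfl, hj, hlj⟩)
    exact ⟨eg.1, eg.2, ej.1, ej.2⟩

/-- two side directions differ by the antipode only when the sides differ. -/
theorem dirOf_eq_of_ne_antip {s s₁ : Fin 2} (h : dirOf s₁ ≠ dirOf s + 2) : s₁ = s := by
  fin_cases s <;> fin_cases s₁ <;> simp [dirOf] at h ⊢

/-- an admissible cover direction at a slice point, if it is a side direction, IS the side of the coordinate. -/
theorem dirOf_eq_of_dirOK {Z : Cell} {f : Fin 4} {s s₁ : Fin 2} (h : DirOK (sliceCell Z f) (dirOf s) (dirOf s₁)) :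
    s₁ = s := by
  rcases h with h | ⟨-, h⟩
  · fin_cases s <;> fin_cases s₁ <;> simp [dirOf] at h ⊢
  · exact dirOf_eq_of_ne_antip h

variable {C : Config} {Z : Cell}

/-- (F1ℝ) «served below on side `s`» gives μ₄ `SettledBelow` in any frame `k` for which `dirOf s` is an admissible direction. -/
theorem settledBelow_slice_of_served {f k : Fin 4} {s : Fin 2} (h : ServedBelow C Z f s)
    (hok : DirOK (sliceCell Z f) k (dirOf s)) : SettledBelow (sliceConfig C) (sliceCell Z) f k := by
  obtain ⟨P, hP, hag, hlt⟩ := h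
  refine ⟨dirOf s, ?_, sliceCell P, Finset.mem_image_of_mem _ hP, (uPartner_slice_iff P Z f _).2 ⟨s, rfl, hag, hlt⟩⟩
  rcases hok with h | ⟨-, h⟩
  · rw [h]; fin_cases k <;> decide
  · exact h

/-- conversely, μ₄ `SettledBelow` in the frame `dirOf s` of a slice configuration is (F1ℝ) service below on side `s`. -/
theorem servedBelow_of_settled_slice {f : Fin 4} {s : Fin 2}
    (h : SettledBelow (sliceConfig C) (sliceCell Z) f (dirOf s)) : ServedBelow C Z f s := by
  obtain ⟨r, hr, P', hP', hu⟩ := h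
  obtain ⟨P, hP, rfl⟩ := Finset.mem_image.1 hP'
  obtain ⟨s₁, rfl, hag, hlt⟩ := (uPartner_slice_iff P Z f r).1 hu
  obtain rfl := dirOf_eq_of_ne_antip hr
  exact ⟨P, hP, hag, hlt⟩

/-- (F1ℝ) «served above on side `s`» gives μ₄ `SettledAbove` in any frame `k` admitting `dirOf s`. -/
theorem settledAbove_slice_of_served {P : Cell} {f k : Fin 4} {s : Fin 2} (h : ServedAbove C P f s)
    (hok : DirOK (sliceCell P f) k (dirOf s)) : SettledAbove (sliceConfig C) (sliceCell P) f k := by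
  obtain ⟨N, hN, hag, hlt⟩ := h
  have hag' : Agree1 P N f s := fun g r hgr => (hag g r hgr).symm
  refine ⟨dirOf s, ?_, sliceCell N, Finset.mem_image_of_mem _ hN, (uPartner_slice_iff P N f _).2 ⟨s, rfl, hag', hlt⟩⟩
  rcases hok with h | ⟨-, h⟩
  · rw [h]; fin_cases k <;> decide
  · exact h

/-- conversely, μ₄ `SettledAbove` in the frame `dirOf s` of a slice configuration is (F1ℝ) service above on side `s`. -/
theorem servedAbove_of_settled_slice {P : Cell} {f : Fin 4} {s : Fin 2}
    (h : SettledAbove (sliceConfig C) (sliceCell P) f (dirOf s)) : ServedAbove C P f s := by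
  obtain ⟨r, hr, N', hN', hu⟩ := h
  obtain ⟨N, hN, rfl⟩ := Finset.mem_image.1 hN'
  obtain ⟨s₁, rfl, hag, hlt⟩ := (uPartner_slice_iff P N f r).1 hu
  obtain rfl := dirOf_eq_of_ne_antip hr
  exact ⟨N, hN, fun g r hgr => (hag g r hgr).symm, hlt⟩

/-- an (F1ℝ) (r2a) cover below on sides `(s, t)` gives a μ₄ `CoveredBelow` in any frames `(k, k′)` admitting `(dirOf s, dirOf t)`. -/
theorem coveredBelow_slice_of_cover {g j k k' : Fin 4} (hgj : g ≠ j) {s t : Fin 2} (h : CoverBelow C Z g s j t)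
    (hs : DirOK (sliceCell Z g) k (dirOf s)) (ht : DirOK (sliceCell Z j) k' (dirOf t)) :
    CoveredBelow (sliceConfig C) (sliceCell Z) g k j k' := by
  obtain ⟨P, hP, hag, hlg, hlj⟩ := h
  exact ⟨dirOf s, dirOf t, hs, ht, sliceCell P, Finset.mem_image_of_mem _ hP,
    (cover_slice_iff P Z hgj _ _).2 ⟨s, t, rfl, rfl, hag, hlg, hlj⟩⟩

/-- conversely, a μ₄ `CoveredBelow` of a slice configuration in the frames `(dirOf s, dirOf t)` is an (F1ℝ) cover below on `(s, t)`. -/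
theorem coverBelow_of_covered_slice {g j : Fin 4} (hgj : g ≠ j) {s t : Fin 2}
    (h : CoveredBelow (sliceConfig C) (sliceCell Z) g (dirOf s) j (dirOf t)) : CoverBelow C Z g s j t := by
  obtain ⟨a, b, ha, hb, P', hP', hcov⟩ := h
  obtain ⟨P, hP, rfl⟩ := Finset.mem_image.1 hP'
  obtain ⟨s₁, t₁, rfl, rfl, hag, hlg, hlj⟩ := (cover_slice_iff P Z hgj a b).1 hcov
  obtain rfl := dirOf_eq_of_dirOK ha
  obtain rfl := dirOf_eq_of_dirOK hb
  exact ⟨P, hP, hag, hlg, hlj⟩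

/-- an (F1ℝ) (r2a) cover above on sides `(s, t)` gives a μ₄ `CoveredAbove` in any frames `(k, k′)` admitting `(dirOf s, dirOf t)`. -/
theorem coveredAbove_slice_of_cover {P : Cell} {g j k k' : Fin 4} (hgj : g ≠ j) {s t : Fin 2}
    (h : CoverAbove C P g s j t) (hs : DirOK (sliceCell P g) k (dirOf s)) (ht : DirOK (sliceCell P j) k' (dirOf t)) :
    CoveredAbove (sliceConfig C) (sliceCell P) g k j k' := by
  obtain ⟨N, hN, hag, hlg, hlj⟩ := h
  have hag' : Agree2 P N g s j t := fun h q h1 h2 => (hag h q h1 h2).symm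
  obtain ⟨h1, h2⟩ := (cover_slice_iff P N hgj _ _).2 ⟨s, t, rfl, rfl, hag', hlg, hlj⟩
  exact ⟨dirOf s, dirOf t, hs, ht, sliceCell N, Finset.mem_image_of_mem _ hN, fun h x y => (h1 h x y).symm, h2⟩

/-- conversely, a μ₄ `CoveredAbove` of a slice configuration in the frames `(dirOf s, dirOf t)` is an (F1ℝ) cover above on `(s, t)`. -/
theorem coverAbove_of_covered_slice {P : Cell} {g j : Fin 4} (hgj : g ≠ j) {s t : Fin 2}
    (h : CoveredAbove (sliceConfig C) (sliceCell P) g (dirOf s) j (dirOf t)) : CoverAbove C P g s j t := by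
  obtain ⟨a, b, ha, hb, N', hN', hcov⟩ := h
  obtain ⟨N, hN, rfl⟩ := Finset.mem_image.1 hN'
  obtain ⟨s₁, t₁, rfl, rfl, hag, hlg, hlj⟩ :=
    (cover_slice_iff P N hgj a b).1 ⟨fun h x y => (hcov.1 h x y).symm, hcov.2⟩
  obtain rfl := dirOf_eq_of_dirOK ha
  obtain rfl := dirOf_eq_of_dirOK hb
  exact ⟨N, hN, fun h q h1 h2 => (hag h q h1 h2).symm, hlg, hlj⟩

/-- **SLICE THEOREM, `N`-side**: `Pad4TowerLemmaT.RuleDN` IS RULE D on 𝔅(μ₄) restricted to the (F1ℝ) slice. -/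
theorem ruleDN_iff_slice (C : Config) (Z : Cell) : RuleDN C Z ↔ RuleDMu4N (sliceConfig C) (sliceCell Z) := by
  constructor
  · intro hD g j hgj k k' hk hk' hne
    obtain ⟨s, hs, hks⟩ := slice_pick Z g k hk
    obtain ⟨t, ht, hkt⟩ := slice_pick Z j k' hk'
    have hne' : Z g s ≠ Z j t := fun h => hne (by rw [hs, ht, h])
    rcases hD g j hgj s t hne' with h | h | h
    · exact Or.inl (settledBelow_slice_of_served h hks)
    · exact Or.inr (Or.inl (settledBelow_slice_of_served h hkt))
    · exact Or.inr (Or.inr (coveredBelow_slice_of_cover hgj h hks hkt))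
  · intro hM f g hfg s r hne
    have hne' : coord (sliceCell Z f) (dirOf s) ≠ coord (sliceCell Z g) (dirOf r) := by
      rw [coord_slice_dirOf, coord_slice_dirOf]; omega
    rcases hM f g hfg (dirOf s) (dirOf r) (adapted_slice_dirOf Z f s) (adapted_slice_dirOf Z g r) hne' with h | h | h
    · exact Or.inl (servedBelow_of_settled_slice h)
    · exact Or.inr (Or.inl (servedBelow_of_settled_slice h))
    · exact Or.inr (Or.inr (coverBelow_of_covered_slice hfg h))

/-- **SLICE THEOREM, `P`-side.** -/
theorem ruleDP_iff_slice (C : Config) (P : Cell) : RuleDP C P ↔ RuleDMu4P (sliceConfig C) (sliceCell P) := by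
  constructor
  · intro hD g j hgj k k' hk hk' hne
    obtain ⟨s, hs, hks⟩ := slice_pick P g k hk
    obtain ⟨t, ht, hkt⟩ := slice_pick P j k' hk'
    have hne' : P g s ≠ P j t := fun h => hne (by rw [hs, ht, h])
    rcases hD g j hgj s t hne' with h | h | h
    · exact Or.inl (settledAbove_slice_of_served h hks)
    · exact Or.inr (Or.inl (settledAbove_slice_of_served h hkt))
    · exact Or.inr (Or.inr (coveredAbove_slice_of_cover hgj h hks hkt))
  · intro hM f g hfg s r hne
    have hne' : coord (sliceCell P f) (dirOf s) ≠ coord (sliceCell P g) (dirOf r) := by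
      rw [coord_slice_dirOf, coord_slice_dirOf]; omega
    rcases hM f g hfg (dirOf s) (dirOf r) (adapted_slice_dirOf P f s) (adapted_slice_dirOf P g r) hne' with h | h | h
    · exact Or.inl (servedAbove_of_settled_slice h)
    · exact Or.inr (Or.inl (servedAbove_of_settled_slice h))
    · exact Or.inr (Or.inr (coverAbove_of_covered_slice hfg h))

/-- **SLICE THEOREM**: a (F1ℝ) configuration is RULE-D-closed in the sense of `Pad4TowerLemmaT` iff its slice embedding is
RULE-D-closed on 𝔅(μ₄). -/
theorem ruleDClosed_iff_slice (C : Config) : RuleDClosed C ↔ RuleDMu4Closed (sliceConfig C) := by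
  constructor
  · rintro ⟨hN, hP⟩
    refine ⟨fun Z' hZ' => ?_, fun P' hP' => ?_⟩
    · obtain ⟨Z, hZ, rfl⟩ := Finset.mem_image.1 hZ'
      exact (ruleDN_iff_slice C Z).1 (hN Z hZ)
    · obtain ⟨P, hPm, rfl⟩ := Finset.mem_image.1 hP'
      exact (ruleDP_iff_slice C P).1 (hP P hPm)
  · rintro ⟨hN, hP⟩
    exact ⟨fun Z hZ => (ruleDN_iff_slice C Z).2 (hN _ (Finset.mem_image_of_mem _ hZ)),
      fun P hPm => (ruleDP_iff_slice C P).2 (hP _ (Finset.mem_image_of_mem _ hPm))⟩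

end Slice

end Summit.Ventures.HSemireg.Pad4Tower
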